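import Mathlib.LinearAlgebra.FreeModule.PID
import Mathlib.LinearAlgebra.Matrix.ToLinearEquiv
import Mathlib.LinearAlgebra.QuadraticForm.Basic
import Mathlib.RingTheory.Finiteness.Basic
import Literature.AlgebraicGeometry.Motives.FaltingsEC
import Literature.NumberTheory.EllipticCurves.GaloisActionProofs
import Literature.NumberTheory.EllipticCurves.IsogenyHom
import Literature.NumberTheory.EllipticCurves.FunctionFieldTranslation
import Literature.NumberTheory.EllipticCurves.IsogenyDegree
import Literature.NumberTheory.EllipticCurves.IsogenyDegreeProofs
import Literature.NumberTheory.EllipticCurves.IsogenyHomProofs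
import Literature.NumberTheory.EllipticCurves.IsogenyPolarDegree
import Literature.NumberTheory.EllipticCurves.PointDivisibilityProofs
import Literature.NumberTheory.EllipticCurves.TateModuleFree
import Literature.NumberTheory.EllipticCurves.TateModuleProofs
import HarnessLib

/-!
# Silverman, *AEC*, Thm. III.7.4: the `ℓ`-adic assembly of `linearIndependent_tateModule_map`

D-0014 keeps `Literature/` sorry-free by stating cited results as named facts `def X : Prop`.
This sibling file of `Literature.AlgebraicGeometry.Motives.FaltingsEC` proves the conclusion of the
named fact `Literature.AlgebraicGeometry.Motives.linearIndependent_tateModule_map` (injectivity of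
`Hom_K(E, E') ⊗ ℤ_ℓ → Hom(T_ℓ E, T_ℓ E')` for elliptic curves and `ℓ ≠ char K`; Silverman, *AEC*,
2nd ed., Thm. III.7.4, III.§7) **from** the geometric inputs of the printed proof, which are not
in Mathlib. They enter `Literature.AlgebraicGeometry.Motives.linearIndependent_tateModule_map_of` as explicit hypotheses,
spelled out in elementary terms (each is the body of a named fact of the elliptic-curve
literature files, cited there and recalled here):

* `hHom` — **`Hom_K(E, E')` is a group**: an additive map `E(K̄) → E'(K̄)` in the `ℤ`-span of the
  isogenies over `K` is `0` or an isogeny over `K`, i.e. sums and negatives of isogenies are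
  isogenies or zero (*AEC* III.§4, the paragraph introducing `Hom(E₁, E₂)`, from Thm. III.3.6);
* `h411` — **isogenies killing `E[m]` factor through `[m]`**: for `m ≠ 0` in `K` and an isogeny
  `ψ` over `K` vanishing on `E[m]` there is an isogeny `λ` over `K` with `ψ = λ ∘ [m]`
  (*AEC* Cor. III.4.11 applied to the separable isogeny `[m]`, Cor. III.5.4);
* `hdiv` — **the statement `(*)` in the proof of *AEC* Thm. III.7.4** in the form it is used:
  for `M ⊆ Hom_K(E, E')` finitely generated, one integer `d ≥ 1` multiplies every
  `f ∈ Hom_K(E, E')` having a positive multiple in `M` into `M` (Silverman: `M^div` is finitely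
  generated — proved from the positive definite quadratic form `deg`, Cor. III.6.3 — whence such a
  `d`, cf. `Literature.AlgebraicGeometry.Motives.exists_pos_forall_smul_mem_of_fg` below);
* `hcard` — **`#E[m] = m²` for `m ≠ 0` in `K`** (*AEC* Cor. III.6.4(b)), the tree's named fact
  `WeierstrassCurve.card_torsionPoints_eq_sq W K̄`, through which the projections
  `T_ℓ E → E[ℓ^n]` are onto (`Literature.NumberTheory.EllipticCurves.TateModule.exists_smul_eq_of_card_torsionBy` of
  `TateModuleProofs`, `Literature.NumberTheory.EllipticCurves.TateModule.exists_proj_eq_of_forall_exists_smul_eq` and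
  `Literature.AlgebraicGeometry.Motives.exists_proj_tateModule_eq_of_card` below).

Everything else — the `ℓ`-adic bookkeeping of the printed proof — is proved here. The corollary
`Literature.AlgebraicGeometry.Motives.linearIndependent_tateModule_map_of_facts` restates the result with the four inputs in
their vendored form, the named facts `WeierstrassCurve.mem_homModule_iff`,
`WeierstrassCurve.Isogeny.exists_eq_comp_nsmul_of_geomTorsion_le_ker`,
`WeierstrassCurve.fg_divHull_homModule` (all of `Literature.NumberTheory.EllipticCurves.IsogenyHom`)
and `WeierstrassCurve.card_torsionPoints_eq_sq W K̄` (`GaloisAction`), and concludes the named fact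
`linearIndependent_tateModule_map ℓ` itself.

The last section sharpens this using the tree's theorem that `[n]` is onto on `E(K̄)`
(`WeierstrassCurve.zsmul_geomPoints_surjective_holds`, file `PointDivisibilityProofs`):
`Literature.AlgebraicGeometry.Motives.linearIndependent_tateModule_map_of_saturation` proves III.7.4 from a single
saturation statement `(sat)` about `Hom_K(E, E')` inside all additive maps `E(K̄) → E'(K̄)`, and
`Literature.AlgebraicGeometry.Motives.linearIndependent_tateModule_map_of_facts₂` needs only the three named facts of
`IsogenyHom` (no `#E[m] = m²`); `mem_homModule_iff` being proved in
`Literature.NumberTheory.EllipticCurves.IsogenyHomProofs`,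
`linearIndependent_tateModule_map_of_facts₃` takes the two remaining ones. **The theorem
`linearIndependent_tateModule_map_holds` is proved at the end of this file** on the degree route
described next, with the polar degree of
`Literature.NumberTheory.EllipticCurves.IsogenyPolarDegree`.

The final section gives a second reduction which does **not** use Cor. III.4.11:
`Literature.AlgebraicGeometry.Motives.linearIndependent_tateModule_map_of_degree` proves III.7.4 from any function
`deg : Hom(E(K̄), E'(K̄)) → ℤ` which on `Hom_K(E, E')` satisfies the parallelogram law and is
positive on non-zero elements (Silverman, Cor. III.6.3: `deg` is a positive definite quadratic
form) and has `#ker φ ∣ deg φ` for every isogeny `φ` (Thm. III.4.10(a): `#ker φ = deg_s φ`). The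
saturation statement `(sat)_ℓ` is obtained from these by a Gram-determinant argument
(`Literature.AlgebraicGeometry.Motives.exists_pos_forall_smul_mem_of_parallelogram`, see "The degree route" below), using
`#E[ℓ^n] = ℓ^{2n}` (`WeierstrassCurve.card_torsionPoints_eq_sq_holds`, `GaloisActionProofs`) in
place of the factorisation through `[ℓ^n]`. What remains for
`linearIndependent_tateModule_map_holds` on this route is a degree function with the two printed
properties III.6.3 and III.4.10(a): `Literature.NumberTheory.EllipticCurves.IsogenyDegree` defines
Silverman's `deg φ = [K̄(E) : φ^* K̄(E')]` for the prelude's isogenies and vendors *AEC*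
Thm. II.2.4(a) (finiteness), Thm. III.4.10(a) (`#ker φ = deg_s φ`) and Cor. III.6.3 (quadratic
form) as named facts over it; `Literature.AlgebraicGeometry.Motives.linearIndependent_tateModule_map_of_degreeFacts` derives
the named fact `linearIndependent_tateModule_map ℓ` from exactly these three. Two of the three are
meanwhile theorems of the tree: II.2.4(a) (`WeierstrassCurve.Isogeny.finiteDimensional_pullbackField_holds`,
file `IsogenyDegreeProofs`: `trdeg K̄(E) = 1`) and the divisibility `#ker φ ∣ deg φ`
(`WeierstrassCurve.Isogeny.card_ker_dvd_deg_holds`, file `FunctionFieldTranslation`: the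
Galois-theoretic argument of Silverman's proof of III.4.10(b), `ker φ ↪ Aut(K̄(E)/φ^* K̄(E'))` by
translations, and Artin's theorem); so **`Literature.AlgebraicGeometry.Motives.linearIndependent_tateModule_map_of_isQuadraticForm`
derives `linearIndependent_tateModule_map ℓ` from the single remaining named fact
`WeierstrassCurve.degHom_isQuadraticForm W W'`** (Cor. III.6.3: `deg` is a quadratic form on
`Hom_K(E, E')`, whose printed proof rests on the dual isogeny, Thm. III.6.1–6.2).

Finally, **`linearIndependent_tateModule_map_holds`** feeds
`linearIndependent_tateModule_map_of_degree` with a degree function for which all three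
properties are theorems of the tree: the **polar degree**
`deg f = d(f(x, y)) = Σ_{P : f(x,y)(P) = O'} e(P)` of the `L`-point `f(x, y) ∈ E'(K̄(E))`
attached to `f ∈ Hom_K(E, E')` (`WeierstrassCurve.polarDegHom`, file `IsogenyPolarDegree`, built
on `WeierstrassPlaces`, `FunctionFieldLPoints`, `LPointPolarDegree`): the parallelogram law
(Cor. III.6.3) is proved there by counting poles of `x(A) - x(B)` on `E` instead of through the
dual isogeny, positivity is `deg φ ≥ 1`, and `#ker φ ∣ deg φ` comes from the constancy of the
fibre degree (Prop. II.2.6(a)) and of the ramification index along `ker φ`-cosets (kernel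
translations, as in the proof of Thm. III.4.10).

## The argument (Silverman's proof of III.7.4, in a basis-free form)

Let `φ_i` (`i ∈ s`, finite) be `ℤ`-independent isogenies over `K`, `M = Σ ℤ φ_i ⊆ Hom_K(E, E')`,
and suppose `Σ α_i T_ℓ(φ_i) = 0` with `α_i ∈ ℤ_ℓ`. Let `d ≥ 1` be as in `hdiv`. Fix `n`, pick
integers `a_i ≡ α_i (mod ℓ^n)` and put `ψ = Σ a_i φ_i ∈ M`. Every `P ∈ E[ℓ^n]` is the `n`-th
component of some `x ∈ T_ℓ E`, and `ψ P = (Σ a_i T_ℓ(φ_i) x)_n = (ℓ^n y)_n = 0`; so `ψ` (zero or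
an isogeny, `Hom_K` being a group) factors as `ψ = λ ∘ [ℓ^n] = ℓ^n λ` (III.4.11), and `d λ ∈ M`.
Writing `d λ = Σ b_i φ_i` and comparing `d ψ = Σ d a_i φ_i = Σ ℓ^n b_i φ_i` coefficientwise
(independence of the `φ_i`) gives `d a_i = ℓ^n b_i`, whence `ℓ^n ∣ d α_i` in `ℤ_ℓ`. As `n` is
arbitrary, `d α_i = 0`, so `α_i = 0`. (Silverman instead expresses everything in a `ℤ`-basis of
the free module `M^div`; the integer `d` replaces that choice and avoids Prop. III.4.2(b).)

## The degree route (a variant of the printed proof avoiding Cor. III.4.11)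

Let `M = ⊕ ℤ φ_i ⊆ Hom_K(E, E')` with `ℤ`-basis `φ_i`, let `⟨φ, ψ⟩ = deg(φ + ψ) - deg φ - deg ψ`
(bilinear on `Hom_K`, Cor. III.6.3) and `G = (⟨φ_i, φ_j⟩)`, an integer matrix with `det G ≠ 0`
because `c G cᵗ = 2 deg(Σ c_i φ_i) > 0` for `c ≠ 0`. If `f` is additive with
`ψ = ℓ^n f = Σ a_i φ_i ∈ M`, then `ψ`, `ℓ^n φ_j` and `ψ + ℓ^n φ_j = ℓ^n (f + φ_j)` lie in `M` and
kill `E[ℓ^n]`, a group of order `ℓ^{2n}` (`ℓ ≠ char K`), so `ℓ^{2n}` divides `#ker`, hence `deg`, of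
each of them (III.4.10(a); `deg 0 = 0`), and therefore `ℓ^{2n} ∣ ⟨ψ, ℓ^n φ_j⟩ = ℓ^n (G a)_j`. Thus
`G a ∈ ℓ^n ℤ^r`, `det(G) a = adj(G) G a ∈ ℓ^n ℤ^r`, say `det(G) a_i = ℓ^n b_i`, and
`ℓ^n det(G) f = det(G) ψ = ℓ^n Σ b_i φ_i` gives `det(G) f = Σ b_i φ_i ∈ M` since
`Hom(E(K̄), E'(K̄))` is torsion-free (`[m]` is onto). So `d = |det G|` works in `(sat)_ℓ`.

## References

* [SilvermanAEC2009] J. H. Silverman, *The Arithmetic of Elliptic Curves*, 2nd ed., GTM 106,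
  Springer 2009, III.§7 (pp. 87 ff.), Thm. III.7.4 and its proof (statement `(*)`);
  Thm. III.3.6, Thm. III.4.10 (p. 71), Cor. III.4.11, Cor. III.5.4, Cor. III.6.3 (p. 81),
  Cor. III.6.4(b); VIII.§2 (the sequence `0 → E[m] → E(K̄) → E(K̄) → 0`).
-/

noncomputable section

open scoped Classical
open scoped AddSubgroup

universe u v

namespace Literature.AlgebraicGeometry.Motives

/-! ## Generic lemmas -/

section Generic

variable {V : Type v} [AddCommGroup V] {M : Submodule ℤ V}

/-- If a finitely generated `ℤ`-submodule `N'` consists of elements having a positive multiple in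
`M`, then a single positive integer `d` multiplies all of `N'` into `M` (take the product of the
multipliers of a finite generating set). Applied to `N' = M^div` this turns the statement `(*)` of
Silverman, *AEC*, proof of Thm. III.7.4 (`M^div` is finitely generated) into the bounded-exponent
form used below. [folklore] -/
theorem exists_pos_forall_smul_mem_of_fg {N' : Submodule ℤ V} (hfg : N'.FG)
    (h : ∀ f ∈ N', ∃ m : ℤ, 0 < m ∧ m • f ∈ M) :
    ∃ d : ℤ, 0 < d ∧ ∀ f ∈ N', d • f ∈ M := by
  obtain ⟨S, hS⟩ := hfg
  have hmul : ∀ f : V, ∃ m : ℤ, 0 < m ∧ (f ∈ N' → m • f ∈ M) := fun f ↦ by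
    by_cases hf : f ∈ N'
    · obtain ⟨m, hm, hmf⟩ := h f hf
      exact ⟨m, hm, fun _ ↦ hmf⟩
    · exact ⟨1, one_pos, fun h' ↦ (hf h').elim⟩
  choose m hm_pos hm_mem using hmul
  refine ⟨∏ f ∈ S, m f, Finset.prod_pos fun f _ ↦ hm_pos f, fun f hf ↦ ?_⟩
  rw [← hS] at hf
  induction hf using Submodule.span_induction with
  | mem g hg =>
    obtain ⟨c, hc⟩ : m g ∣ ∏ f ∈ S, m f := Finset.dvd_prod_of_mem m hg
    have hgN : g ∈ N' := by rw [← hS]; exact Submodule.subset_span hg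
    rw [hc, mul_comm, mul_smul]
    exact M.smul_mem c (hm_mem g hgN)
  | zero => rw [smul_zero]; exact M.zero_mem
  | add f g _ _ hf hg => rw [smul_add]; exact M.add_mem hf hg
  | smul c f _ hf => rw [smul_comm]; exact M.smul_mem c hf

/-- An `ℓ`-adic integer divisible by every power of `ℓ` is `0`
(Mathlib `PadicInt.ext_of_toZModPow`, `PadicInt.ker_toZModPow`). [folklore] -/
theorem padicInt_eq_zero_of_forall_pow_dvd {p : ℕ} [Fact p.Prime] {x : ℤ_[p]}
    (h : ∀ n : ℕ, (p : ℤ_[p]) ^ n ∣ x) : x = 0 :=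
  PadicInt.ext_of_toZModPow.mp fun n ↦ by
    rw [map_zero, ← RingHom.mem_ker, PadicInt.ker_toZModPow, Ideal.mem_span_singleton]
    exact h n

/-- If multiplication by `p` maps `A[p^{k+1}]` onto `A[p^k]` for every `k`, then every projection
`T_p A → A[p^n]` is onto: lift `x ∈ A[p^n]` recursively to `Q_k ∈ A[p^{n+k}]` (`Q_0 = x`,
`p • Q_{k+1} = Q_k`) and take the compatible sequence `(p^n • Q_m)_m`. (Level-`n` version of
`exists_proj_one_eq` of `TateModuleProofs`; Silverman, *AEC*, III.§7, "the inverse limit ... with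
respect to the (surjective) maps `[ℓ]`".) [folklore] -/
theorem _root_.Literature.NumberTheory.EllipticCurves.TateModule.exists_proj_eq_of_forall_exists_smul_eq {A : Type u} [AddCommGroup A] {p : ℕ}
    (hs : ∀ (k : ℕ) (P : A), P ∈ A[(p ^ k : ℕ)] → ∃ Q ∈ A[(p ^ (k + 1) : ℕ)], p • Q = P)
    (n : ℕ) {x : A} (hx : x ∈ A[(p ^ n : ℕ)]) :
    ∃ a : Literature.NumberTheory.EllipticCurves.TateModule A p, Literature.NumberTheory.EllipticCurves.TateModule.proj p n a = x := by
  choose lft hlft_mem hlft_eq using hs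
  -- the recursive lift `Q k ∈ A[p^(n+k)]`, `Q 0 = x`, `p • Q (k+1) = Q k`
  let Q : (k : ℕ) → A[(p ^ (n + k) : ℕ)] := fun k ↦
    Nat.rec (motive := fun k ↦ A[(p ^ (n + k) : ℕ)]) ⟨x, hx⟩
      (fun k Qk ↦ ⟨lft (n + k) Qk.1 Qk.2, hlft_mem (n + k) Qk.1 Qk.2⟩) k
  have hQ0 : (Q 0 : A) = x := rfl
  have hQs : ∀ k, p • (Q (k + 1) : A) = Q k := fun k ↦ hlft_eq (n + k) (Q k).1 (Q k).2
  have hQ' : ∀ k j, p ^ k • (Q (j + k) : A) = Q j := by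
    intro k
    induction k with
    | zero => intro j; simp
    | succ k ih =>
      intro j
      rw [pow_succ, mul_smul]
      change p ^ k • p • (Q (j + k + 1) : A) = _
      rw [hQs, ih]
  refine ⟨Literature.NumberTheory.EllipticCurves.TateModule.mk (fun m ↦ p ^ n • (Q m : A)) (fun m ↦ ?_) (fun m ↦ ?_), ?_⟩
  · rw [← mul_smul, ← pow_add, add_comm]
    exact AddSubgroup.torsionBy.nsmul_iff.mp (Q m).2
  · rw [smul_comm, hQs]
  · rw [Literature.NumberTheory.EllipticCurves.TateModule.proj_mk]
    have := hQ' n 0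
    rw [Nat.zero_add] at this
    rw [this, hQ0]

end Generic

end Literature.AlgebraicGeometry.Motives

/-! ## Silverman III.7.4 from its geometric inputs -/

namespace Literature.AlgebraicGeometry.Motives

open WeierstrassCurve

variable {K : Type u} [Field K] {W W' : WeierstrassCurve K} (ℓ : ℕ) [Fact ℓ.Prime]

/-- For an elliptic curve `E / K`, a prime `ℓ ≠ 0` in `K` and `#E[m] = m²` for `m ≠ 0` in `K`
(hypothesis `hcard`, the named fact `card_torsionPoints_eq_sq W K̄`, *AEC* Cor. III.6.4(b)), every
projection `T_ℓ E → E[ℓ^n]` is onto: `#E[ℓ^k] = ℓ^{2k}` makes `[ℓ] : E[ℓ^{k+1}] → E[ℓ^k]` onto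
(`TateModuleProofs`), and compatible lifts assemble into an element of `T_ℓ E`. This is the case
`ℓ ≠ char K` of the named fact `WeierstrassCurve.proj_surjective_of_isAlgClosed W ℓ`.
Silverman, *AEC*, III.§7 ("the (surjective) maps `[ℓ]`"). [folklore] -/
theorem exists_proj_tateModule_eq_of_card [W.IsElliptic]
    (hcard : card_torsionPoints_eq_sq W (AlgebraicClosure K)) (hℓ : (ℓ : K) ≠ 0) (n : ℕ)
    {P : W.geomPoints} (hP : P ∈ geomTorsion W (ℓ ^ n : ℕ)) :
    ∃ x : W.tateModule ℓ, Literature.NumberTheory.EllipticCurves.TateModule.proj ℓ n x = P :=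
  Literature.NumberTheory.EllipticCurves.TateModule.exists_proj_eq_of_forall_exists_smul_eq
    (fun k _ hQ ↦ Literature.NumberTheory.EllipticCurves.TateModule.exists_smul_eq_of_card_torsionBy
      (card_geomTorsion_pow_eq W ℓ hcard hℓ) k hQ) n hP

/-- **Silverman, *AEC*, Thm. III.7.4, from its geometric inputs.** Let `E, E'` be elliptic curves
over `K` and `ℓ` a prime with `ℓ ≠ 0` in `K`. Assume: (`hHom`) the `ℤ`-span of the isogenies
`E → E'` over `K` inside `Hom(E(K̄), E'(K̄))` consists of `0` and the isogenies (`Hom_K(E, E')` is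
a group, *AEC* III.§4 with Thm. III.3.6); (`h411`) an isogeny over `K` killing `E[m]`, `m ≠ 0` in
`K`, factors through `[m]` (*AEC* Cor. III.4.11 with Cor. III.5.4); (`hdiv`) for every finitely
generated `M ⊆ Hom_K(E, E')` some integer `d ≥ 1` has `d • f ∈ M` whenever `f ∈ Hom_K(E, E')`
has a positive multiple in `M` (from `(*)` of the proof of *AEC* Thm. III.7.4: `M^div` is
finitely generated); (`hcard`) `#E[m] = m²` for `m ≠ 0` in `K` (*AEC* Cor. III.6.4(b)). Then
`ℤ`-linearly independent isogenies `φ i : E → E'` over `K` have `ℤ_ℓ`-linearly independent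
Tate-module maps `T_ℓ (φ i)`; that is, the conclusion of `linearIndependent_tateModule_map ℓ`
holds. The proof is the printed `ℓ`-adic argument (module docstring).
[cite: SilvermanAEC2009, Thm. III.7.4 (proof)] -/
theorem linearIndependent_tateModule_map_of [W.IsElliptic] [W'.IsElliptic]
    (hHom : ∀ f : W.geomPoints →+ W'.geomPoints,
      f ∈ Submodule.span ℤ (Set.range
          (Isogeny.toAddMonoidHom : Isogeny W W' → W.geomPoints →+ W'.geomPoints)) ↔
        f = 0 ∨ ∃ φ : Isogeny W W', φ.toAddMonoidHom = f)
    (h411 : ∀ {m : ℕ}, (m : K) ≠ 0 → ∀ ψ : Isogeny W W',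
      (∀ P ∈ geomTorsion W m, ψ P = 0) → ∃ lam : Isogeny W W', ∀ P, ψ P = lam (m • P))
    (hdiv : ∀ M : Submodule ℤ (W.geomPoints →+ W'.geomPoints),
      M ≤ Submodule.span ℤ (Set.range
          (Isogeny.toAddMonoidHom : Isogeny W W' → W.geomPoints →+ W'.geomPoints)) →
      M.FG → ∃ d : ℤ, 0 < d ∧ ∀ f ∈ Submodule.span ℤ (Set.range
          (Isogeny.toAddMonoidHom : Isogeny W W' → W.geomPoints →+ W'.geomPoints)),
        ∀ m : ℤ, 0 < m → m • f ∈ M → d • f ∈ M)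
    (hcard : card_torsionPoints_eq_sq W (AlgebraicClosure K))
    (hℓ : (ℓ : K) ≠ 0) {ι : Type v} (φ : ι → Isogeny W W')
    (hφ : LinearIndependent ℤ fun i ↦ (φ i).toAddMonoidHom) :
    LinearIndependent ℤ_[ℓ] fun i ↦ Literature.NumberTheory.EllipticCurves.TateModule.map ℓ (φ i).toAddMonoidHom := by
  -- notation: `S = Hom_K(E, E')` inside `Hom(E(K̄), E'(K̄))`
  set S : Submodule ℤ (W.geomPoints →+ W'.geomPoints) := Submodule.span ℤ (Set.range
    (Isogeny.toAddMonoidHom : Isogeny W W' → W.geomPoints →+ W'.geomPoints)) with hS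
  have hmemS : ∀ χ : Isogeny W W', χ.toAddMonoidHom ∈ S := fun χ ↦
    Submodule.subset_span ⟨χ, rfl⟩
  have hℓ' : ∀ n : ℕ, ((ℓ ^ n : ℕ) : K) ≠ 0 := fun n ↦ by
    rw [Nat.cast_pow]
    exact pow_ne_zero _ hℓ
  -- reduce to a finite subfamily `s`
  rw [linearIndependent_iff_finset_linearIndependent]
  intro s
  have hφs : LinearIndependent ℤ fun i : s ↦ (φ i).toAddMonoidHom :=
    hφ.comp (Subtype.val : s → ι) Subtype.val_injective
  -- `M = Σ ℤ φ_i ⊆ S`, and `d ≥ 1` with `d f ∈ M` whenever `f ∈ S` has a positive multiple in `M`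
  set M : Submodule ℤ (W.geomPoints →+ W'.geomPoints) :=
    Submodule.span ℤ (Set.range fun i : s ↦ (φ i).toAddMonoidHom) with hM
  have hMle : M ≤ S :=
    Submodule.span_le.mpr (by rintro _ ⟨i, rfl⟩; exact hmemS (φ i))
  have hMfg : M.FG := Submodule.fg_span (Set.finite_range _)
  obtain ⟨d, hd, hdM⟩ := hdiv M hMle hMfg
  -- the Tate-module maps
  set T : s → W.tateModule ℓ →ₗ[ℤ_[ℓ]] W'.tateModule ℓ :=
    fun i ↦ Literature.NumberTheory.EllipticCurves.TateModule.map ℓ (φ i).toAddMonoidHom with hT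
  rw [Fintype.linearIndependent_iff]
  intro α hα
  change ∑ i, α i • T i = 0 at hα
  -- main claim: `ℓ^n ∣ d α_i` for every `n`
  suffices key : ∀ (n : ℕ) (i : s), (ℓ : ℤ_[ℓ]) ^ n ∣ (d : ℤ_[ℓ]) * α i by
    intro i
    have h0 : (d : ℤ_[ℓ]) * α i = 0 := padicInt_eq_zero_of_forall_pow_dvd fun n ↦ key n i
    exact (mul_eq_zero.mp h0).resolve_left (Int.cast_ne_zero.mpr hd.ne')
  intro n i₀
  -- integers `a_i ≡ α_i (mod ℓ^n)`
  set a : s → ℕ := fun i ↦ PadicInt.appr (α i) n with ha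
  have hβex : ∀ i, ∃ β : ℤ_[ℓ], α i - (a i : ℤ_[ℓ]) = (ℓ : ℤ_[ℓ]) ^ n * β := fun i ↦
    Ideal.mem_span_singleton.mp (PadicInt.appr_spec n (α i))
  choose β hβ using hβex
  have hβ' : ∀ i, ((a i : ℤ) : ℤ_[ℓ]) = α i - (ℓ : ℤ_[ℓ]) ^ n * β i := fun i ↦ by
    rw [Int.cast_natCast, ← hβ i, sub_sub_cancel]
  -- `ψ = Σ a_i φ_i ∈ M`
  set ψ : W.geomPoints →+ W'.geomPoints := ∑ i, (a i : ℤ) • (φ i).toAddMonoidHom with hψ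
  have hψM : ψ ∈ M :=
    Submodule.sum_mem _ fun i _ ↦ M.smul_mem _ (Submodule.subset_span ⟨i, rfl⟩)
  -- `ψ` kills `E[ℓ^n]`
  have hψtors : ∀ P ∈ geomTorsion W (ℓ ^ n : ℕ), ψ P = 0 := by
    intro P hP
    obtain ⟨x, rfl⟩ := exists_proj_tateModule_eq_of_card ℓ hcard hℓ n hP
    have h1 : ψ (Literature.NumberTheory.EllipticCurves.TateModule.proj ℓ n x) =
        Literature.NumberTheory.EllipticCurves.TateModule.proj ℓ n (∑ i, ((a i : ℤ) : ℤ_[ℓ]) • T i x) := by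
      rw [hψ, AddMonoidHom.finsetSum_apply, map_sum]
      refine Finset.sum_congr rfl fun i _ ↦ ?_
      rw [AddMonoidHom.smul_apply, Int.cast_smul_eq_zsmul, map_zsmul]
      rfl
    have h0 : ∑ i, α i • T i x = 0 := by
      have := congrArg (fun g : W.tateModule ℓ →ₗ[ℤ_[ℓ]] W'.tateModule ℓ ↦ g x) hα
      simpa only [LinearMap.coe_sum, Finset.sum_apply, LinearMap.smul_apply,
        LinearMap.zero_apply] using this
    have h2 : ∑ i, ((a i : ℤ) : ℤ_[ℓ]) • T i x = (ℓ : ℤ_[ℓ]) ^ n • ∑ i, (-β i) • T i x := by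
      calc ∑ i, ((a i : ℤ) : ℤ_[ℓ]) • T i x
          = ∑ i, (α i • T i x - ((ℓ : ℤ_[ℓ]) ^ n * β i) • T i x) :=
            Finset.sum_congr rfl fun i _ ↦ by rw [hβ' i, sub_smul]
        _ = ∑ i, α i • T i x - ∑ i, ((ℓ : ℤ_[ℓ]) ^ n * β i) • T i x :=
            Finset.sum_sub_distrib _ _
        _ = (ℓ : ℤ_[ℓ]) ^ n • ∑ i, (-β i) • T i x := by
            rw [h0, zero_sub, Finset.smul_sum, ← Finset.sum_neg_distrib]
            refine Finset.sum_congr rfl fun i _ ↦ ?_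
            rw [mul_smul, neg_smul, smul_neg]
    rw [h1, h2, Literature.NumberTheory.EllipticCurves.TateModule.proj_pow_smul, Literature.NumberTheory.EllipticCurves.TateModule.pow_smul_proj]
  -- hence `ψ = ℓ^n g` with `d g ∈ M` (III.4.11, or `ψ = 0`)
  have hψg : ∃ g : W.geomPoints →+ W'.geomPoints, d • g ∈ M ∧ ψ = ((ℓ ^ n : ℕ) : ℤ) • g := by
    rcases (hHom ψ).mp (hMle hψM) with h0 | ⟨χ, hχ⟩
    · exact ⟨0, by rw [smul_zero]; exact M.zero_mem, by rw [h0, smul_zero]⟩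
    · obtain ⟨lam, hlam⟩ := h411 (hℓ' n) χ fun P hP ↦ by
        rw [← Isogeny.coe_toAddMonoidHom, hχ]; exact hψtors P hP
      have hχlam : χ.toAddMonoidHom = ((ℓ ^ n : ℕ) : ℤ) • lam.toAddMonoidHom := by
        ext P
        rw [AddMonoidHom.smul_apply, natCast_zsmul, Isogeny.coe_toAddMonoidHom,
          Isogeny.coe_toAddMonoidHom, hlam P, map_nsmul]
      refine ⟨lam.toAddMonoidHom, hdM _ (hmemS lam) ((ℓ ^ n : ℕ) : ℤ) ?_ ?_, ?_⟩
      · exact_mod_cast pow_pos (Fact.out : ℓ.Prime).pos n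
      · rw [← hχlam, hχ]; exact hψM
      · rw [← hχlam, hχ]
  obtain ⟨g, hgM, hψg⟩ := hψg
  -- `d g = Σ b_i φ_i`
  obtain ⟨b, hb⟩ := (Submodule.mem_span_range_iff_exists_fun ℤ).mp hgM
  -- compare coefficients of `d ψ`
  have hcoeff : ∀ i, d * (a i : ℤ) - ((ℓ ^ n : ℕ) : ℤ) * b i = 0 := by
    refine Fintype.linearIndependent_iff.mp hφs _ ?_
    calc ∑ i, (d * (a i : ℤ) - ((ℓ ^ n : ℕ) : ℤ) * b i) • (φ i).toAddMonoidHom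
        = d • ψ - ((ℓ ^ n : ℕ) : ℤ) • ∑ i, b i • (φ i).toAddMonoidHom := by
          rw [hψ, Finset.smul_sum, Finset.smul_sum, ← Finset.sum_sub_distrib]
          refine Finset.sum_congr rfl fun i _ ↦ ?_
          rw [sub_smul, mul_smul, mul_smul]
      _ = 0 := by rw [hb, hψg, smul_comm, sub_self]
  -- conclude `ℓ^n ∣ d α_{i₀}`
  have hi₀ : (d : ℤ_[ℓ]) * (a i₀ : ℤ_[ℓ]) = (ℓ : ℤ_[ℓ]) ^ n * (b i₀ : ℤ_[ℓ]) := by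
    have := congrArg (fun z : ℤ ↦ (z : ℤ_[ℓ])) (sub_eq_zero.mp (hcoeff i₀))
    push_cast at this
    exact this
  refine ⟨(b i₀ : ℤ_[ℓ]) + (d : ℤ_[ℓ]) * β i₀, ?_⟩
  have hαi : α i₀ = (a i₀ : ℤ_[ℓ]) + (ℓ : ℤ_[ℓ]) ^ n * β i₀ := by
    rw [← hβ i₀, add_sub_cancel]
  rw [hαi, mul_add, hi₀]
  ring

/-! ## Silverman III.7.4 from the named facts of `IsogenyHom` and `GaloisAction` -/

/-- A finitely generated divisible hull `M^div = Literature.divHull N M` admits one integer `d ≥ 1` with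
`d • f ∈ M` for every `f ∈ N` having a positive multiple in `M` (i.e. `d • M^div ⊆ M`). This is how
statement `(*)` of the proof of *AEC* Thm. III.7.4 is consumed above (hypothesis `hdiv` of
`linearIndependent_tateModule_map_of`). [folklore] -/
theorem exists_pos_forall_smul_mem_of_fg_divHull {V : Type v} [AddCommGroup V]
    {N M : Submodule ℤ V} (hfg : (Literature.NumberTheory.EllipticCurves.divHull N M).FG) :
    ∃ d : ℤ, 0 < d ∧ ∀ f ∈ N, ∀ m : ℤ, 0 < m → m • f ∈ M → d • f ∈ M := by
  obtain ⟨d, hd, h⟩ := exists_pos_forall_smul_mem_of_fg hfg fun _ hf ↦ hf.2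
  exact ⟨d, hd, fun f hf m hm hmf ↦ h f ⟨hf, m, hm, hmf⟩⟩

/-- **Silverman, *AEC*, Thm. III.7.4, from the named facts.** For Weierstrass curves `W, W'` over
`K` and a prime `ℓ`, the named fact `linearIndependent_tateModule_map ℓ` (for `E, E'` elliptic and
`ℓ ≠ 0` in `K`, `ℤ`-independent isogenies `E → E'` over `K` have `ℤ_ℓ`-independent Tate-module
maps) follows from the named facts `mem_homModule_iff W W'` (`Hom_K(E, E')` is a group, *AEC*
III.§4), `Isogeny.exists_eq_comp_nsmul_of_geomTorsion_le_ker W W'` (*AEC* Cor. III.4.11 with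
Cor. III.5.4), `fg_divHull_homModule W W'` (statement `(*)` in the proof of *AEC* Thm. III.7.4)
and `card_torsionPoints_eq_sq W K̄` (*AEC* Cor. III.6.4(b)), by
`linearIndependent_tateModule_map_of`. [cite: SilvermanAEC2009, Thm. III.7.4 (proof)] -/
theorem linearIndependent_tateModule_map_of_facts
    (hHom : mem_homModule_iff W W')
    (h411 : Isogeny.exists_eq_comp_nsmul_of_geomTorsion_le_ker W W')
    (hdiv : fg_divHull_homModule W W')
    (hcard : card_torsionPoints_eq_sq W (AlgebraicClosure K)) :
    linearIndependent_tateModule_map.{u, v} (W := W) (W' := W') ℓ := by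
  intro _ _ hℓ ι φ hφ
  exact linearIndependent_tateModule_map_of ℓ (fun f ↦ hHom f) (fun hm ψ h ↦ h411 hm ψ h)
    (fun M hM hfg ↦ exists_pos_forall_smul_mem_of_fg_divHull (hdiv M hM hfg)) hcard hℓ φ hφ

/-! ## Silverman III.7.4 with `[n] : E(K̄) → E(K̄)` onto: the saturation form

The tree proves that multiplication by `n ≠ 0` is onto on `E(K̄)`
(`WeierstrassCurve.zsmul_geomPoints_surjective_holds` of `PointDivisibilityProofs`, Silverman,
*AEC*, VIII.§2 with III.4.2(a), II.2.3). This makes two of the four inputs above superfluous: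
the projections `T_ℓ E → E[ℓ^n]` are onto by divisibility (no need for `#E[m] = m²`), and an
additive map killing `E[m]` factors through `[m]` as an *additive* map for free. What remains of
`h411` and `hdiv` together is one saturation statement about `Hom_K(E, E')` inside the group of all
additive maps `E(K̄) → E'(K̄)`:

`(sat)` for `M ⊆ Hom_K(E, E')` finitely generated there is `d ≥ 1` with `d • f ∈ M` for every
additive `f : E(K̄) → E'(K̄)` and every `m ≥ 1` with `m ≠ 0` in `K` and `m • f ∈ M`

(from *AEC*: `m • f = ψ ∈ Hom_K` kills `E[m]`, so `ψ = λ ∘ [m]` with `λ ∈ Hom_K` by Cor. III.4.11,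
`f = λ` because `[m]` is onto, and `λ ∈ M^div`, which is finitely generated by `(*)` of III.7.4).
`linearIndependent_tateModule_map_of_saturation` proves III.7.4 at `ℓ` from `(sat)` restricted to
`m = ℓ^n` alone (`(sat)_ℓ`, which conversely follows from III.7.4 at `ℓ`), and
`linearIndependent_tateModule_map_of_facts₂` derives `(sat)` from the named facts
`mem_homModule_iff`, `Isogeny.exists_eq_comp_nsmul_of_geomTorsion_le_ker` and
`fg_divHull_homModule` (dropping `card_torsionPoints_eq_sq`). The restriction `m ≠ 0` in `K` in
`(sat)` is essential: for `m = p = char K` the additive inverse of the bijection `[p^n]` on the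
points of a supersingular curve is not a morphism, and `(sat)` over all `m ≥ 1` fails.
-/

/-- **Additive factorisation through `[k]`.** If `Q ↦ k • Q` is onto on `A` and the additive map
`ψ : A → B` kills `A[k]`, then `ψ = k • g` for an additive `g : A → B` (namely
`g (k • P) = ψ P`). The group-theoretic shadow of *AEC* Cor. III.4.11 for `φ = [k]`. [folklore] -/
theorem AddMonoidHom.exists_natCast_smul_eq {A B : Type*} [AddCommGroup A]
    [AddCommGroup B] {k : ℕ} (hs : Function.Surjective fun Q : A ↦ (k : ℤ) • Q) (ψ : A →+ B)
    (hψ : ∀ P : A, (k : ℤ) • P = 0 → ψ P = 0) : ∃ g : A →+ B, (k : ℤ) • g = ψ := by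
  choose s hs using hs
  have hadd : ∀ Q Q' : A, ψ (s (Q + Q')) = ψ (s Q) + ψ (s Q') := fun Q Q' ↦ by
    have h0 : (k : ℤ) • (s (Q + Q') - s Q - s Q') = 0 := by
      simp only [smul_sub, hs]; abel
    have h1 := hψ _ h0
    rwa [map_sub, map_sub, sub_sub, sub_eq_zero] at h1
  refine ⟨AddMonoidHom.mk' (fun Q ↦ ψ (s Q)) hadd, ?_⟩
  ext P
  simp only [AddMonoidHom.smul_apply, AddMonoidHom.mk'_apply, ← map_zsmul, hs]

/-- For an elliptic curve `E / K` and a prime `ℓ`, every projection `T_ℓ E → E[ℓ^n]` is onto,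
because `[ℓ]` is onto on `E(K̄)` (`WeierstrassCurve.zsmul_geomPoints_surjective_holds`,
Silverman, *AEC*, VIII.§2) so that compatible `ℓ`-power division points exist
(`Literature.NumberTheory.EllipticCurves.TateModule.exists_proj_eq_of_forall_exists_smul_eq`). Silverman, *AEC*, III.§7
("the (surjective) maps `[ℓ]`"). [folklore] -/
theorem exists_proj_tateModule_eq [W.IsElliptic] (n : ℕ) {P : W.geomPoints}
    (hP : P ∈ geomTorsion W (ℓ ^ n : ℕ)) : ∃ x : W.tateModule ℓ, Literature.NumberTheory.EllipticCurves.TateModule.proj ℓ n x = P := by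
  have hs := zsmul_geomPoints_surjective_holds W (n := (ℓ : ℤ))
    (Int.natCast_ne_zero.mpr (Fact.out : ℓ.Prime).ne_zero)
  refine Literature.NumberTheory.EllipticCurves.TateModule.exists_proj_eq_of_forall_exists_smul_eq (fun k Q hQ ↦ ?_) n hP
  obtain ⟨R, hR⟩ := hs Q
  simp only at hR
  have hR' : ℓ • R = Q := by rw [← natCast_zsmul]; exact hR
  refine ⟨R, ?_, hR'⟩
  rw [AddSubgroup.torsionBy.nsmul_iff] at hQ ⊢
  rw [pow_succ, mul_smul, hR', hQ]

/-- **Silverman, *AEC*, Thm. III.7.4, from the `ℓ`-saturation statement `(sat)_ℓ`.** Let `E, E'`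
be elliptic curves over `K` and `ℓ` a prime. Assume `(sat)_ℓ`: for every finitely generated
`M ⊆ Hom_K(E, E')` some integer `d ≥ 1` has `d • f ∈ M` for every additive `f : E(K̄) → E'(K̄)`
with `ℓ^n • f ∈ M` for some `n`. Then `ℤ`-linearly independent isogenies `E → E'` over `K` have
`ℤ_ℓ`-linearly independent Tate-module maps. The proof is the printed `ℓ`-adic argument (module
docstring), with the projections `T_ℓ E → E[ℓ^n]` onto and the factorisation of `ψ = Σ aᵢφᵢ`
through `[ℓ^n]` both supplied by the surjectivity of `[ℓ^n]` on `E(K̄)`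
(`zsmul_geomPoints_surjective_holds`); no hypothesis `ℓ ≠ char K` is needed at this stage — it
enters only through `(sat)_ℓ`, which fails for `ℓ = char K`.
[cite: SilvermanAEC2009, Thm. III.7.4 (proof)] -/
theorem linearIndependent_tateModule_map_of_saturation [W.IsElliptic] [W'.IsElliptic]
    (hsat : ∀ M : Submodule ℤ (W.geomPoints →+ W'.geomPoints),
      M ≤ Submodule.span ℤ (Set.range
          (Isogeny.toAddMonoidHom : Isogeny W W' → W.geomPoints →+ W'.geomPoints)) →
      M.FG → ∃ d : ℤ, 0 < d ∧ ∀ (f : W.geomPoints →+ W'.geomPoints) (n : ℕ),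
        ((ℓ ^ n : ℕ) : ℤ) • f ∈ M → d • f ∈ M)
    {ι : Type v} (φ : ι → Isogeny W W')
    (hφ : LinearIndependent ℤ fun i ↦ (φ i).toAddMonoidHom) :
    LinearIndependent ℤ_[ℓ] fun i ↦ Literature.NumberTheory.EllipticCurves.TateModule.map ℓ (φ i).toAddMonoidHom := by
  -- notation: `S = Hom_K(E, E')` inside `Hom(E(K̄), E'(K̄))`
  set S : Submodule ℤ (W.geomPoints →+ W'.geomPoints) := Submodule.span ℤ (Set.range
    (Isogeny.toAddMonoidHom : Isogeny W W' → W.geomPoints →+ W'.geomPoints)) with hS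
  have hmemS : ∀ χ : Isogeny W W', χ.toAddMonoidHom ∈ S := fun χ ↦
    Submodule.subset_span ⟨χ, rfl⟩
  -- `[ℓ^n]` is onto on `E(K̄)`
  have hsurj : ∀ n : ℕ, Function.Surjective fun Q : W.geomPoints ↦ ((ℓ ^ n : ℕ) : ℤ) • Q :=
    fun n ↦ zsmul_geomPoints_surjective_holds W
      (Int.natCast_ne_zero.mpr (pow_ne_zero n (Fact.out : ℓ.Prime).ne_zero))
  -- reduce to a finite subfamily `s`
  rw [linearIndependent_iff_finset_linearIndependent]
  intro s
  have hφs : LinearIndependent ℤ fun i : s ↦ (φ i).toAddMonoidHom :=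
    hφ.comp (Subtype.val : s → ι) Subtype.val_injective
  -- `M = Σ ℤ φ_i ⊆ S`, and `d ≥ 1` from `(sat)`
  set M : Submodule ℤ (W.geomPoints →+ W'.geomPoints) :=
    Submodule.span ℤ (Set.range fun i : s ↦ (φ i).toAddMonoidHom) with hM
  have hMle : M ≤ S :=
    Submodule.span_le.mpr (by rintro _ ⟨i, rfl⟩; exact hmemS (φ i))
  have hMfg : M.FG := Submodule.fg_span (Set.finite_range _)
  obtain ⟨d, hd, hdM⟩ := hsat M hMle hMfg
  -- the Tate-module maps
  set T : s → W.tateModule ℓ →ₗ[ℤ_[ℓ]] W'.tateModule ℓ :=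
    fun i ↦ Literature.NumberTheory.EllipticCurves.TateModule.map ℓ (φ i).toAddMonoidHom with hT
  rw [Fintype.linearIndependent_iff]
  intro α hα
  change ∑ i, α i • T i = 0 at hα
  -- main claim: `ℓ^n ∣ d α_i` for every `n`
  suffices key : ∀ (n : ℕ) (i : s), (ℓ : ℤ_[ℓ]) ^ n ∣ (d : ℤ_[ℓ]) * α i by
    intro i
    have h0 : (d : ℤ_[ℓ]) * α i = 0 := padicInt_eq_zero_of_forall_pow_dvd fun n ↦ key n i
    exact (mul_eq_zero.mp h0).resolve_left (Int.cast_ne_zero.mpr hd.ne')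
  intro n i₀
  -- integers `a_i ≡ α_i (mod ℓ^n)`
  set a : s → ℕ := fun i ↦ PadicInt.appr (α i) n with ha
  have hβex : ∀ i, ∃ β : ℤ_[ℓ], α i - (a i : ℤ_[ℓ]) = (ℓ : ℤ_[ℓ]) ^ n * β := fun i ↦
    Ideal.mem_span_singleton.mp (PadicInt.appr_spec n (α i))
  choose β hβ using hβex
  have hβ' : ∀ i, ((a i : ℤ) : ℤ_[ℓ]) = α i - (ℓ : ℤ_[ℓ]) ^ n * β i := fun i ↦ by
    rw [Int.cast_natCast, ← hβ i, sub_sub_cancel]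
  -- `ψ = Σ a_i φ_i ∈ M`
  set ψ : W.geomPoints →+ W'.geomPoints := ∑ i, (a i : ℤ) • (φ i).toAddMonoidHom with hψ
  have hψM : ψ ∈ M :=
    Submodule.sum_mem _ fun i _ ↦ M.smul_mem _ (Submodule.subset_span ⟨i, rfl⟩)
  -- `ψ` kills `E[ℓ^n]`
  have hψtors : ∀ P ∈ geomTorsion W (ℓ ^ n : ℕ), ψ P = 0 := by
    intro P hP
    obtain ⟨x, rfl⟩ := exists_proj_tateModule_eq ℓ n hP
    have h1 : ψ (Literature.NumberTheory.EllipticCurves.TateModule.proj ℓ n x) =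
        Literature.NumberTheory.EllipticCurves.TateModule.proj ℓ n (∑ i, ((a i : ℤ) : ℤ_[ℓ]) • T i x) := by
      rw [hψ, AddMonoidHom.finsetSum_apply, map_sum]
      refine Finset.sum_congr rfl fun i _ ↦ ?_
      rw [AddMonoidHom.smul_apply, Int.cast_smul_eq_zsmul, map_zsmul]
      rfl
    have h0 : ∑ i, α i • T i x = 0 := by
      have := congrArg (fun g : W.tateModule ℓ →ₗ[ℤ_[ℓ]] W'.tateModule ℓ ↦ g x) hα
      simpa only [LinearMap.coe_sum, Finset.sum_apply, LinearMap.smul_apply,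
        LinearMap.zero_apply] using this
    have h2 : ∑ i, ((a i : ℤ) : ℤ_[ℓ]) • T i x = (ℓ : ℤ_[ℓ]) ^ n • ∑ i, (-β i) • T i x := by
      calc ∑ i, ((a i : ℤ) : ℤ_[ℓ]) • T i x
          = ∑ i, (α i • T i x - ((ℓ : ℤ_[ℓ]) ^ n * β i) • T i x) :=
            Finset.sum_congr rfl fun i _ ↦ by rw [hβ' i, sub_smul]
        _ = ∑ i, α i • T i x - ∑ i, ((ℓ : ℤ_[ℓ]) ^ n * β i) • T i x :=
            Finset.sum_sub_distrib _ _
        _ = (ℓ : ℤ_[ℓ]) ^ n • ∑ i, (-β i) • T i x := by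
            rw [h0, zero_sub, Finset.smul_sum, ← Finset.sum_neg_distrib]
            refine Finset.sum_congr rfl fun i _ ↦ ?_
            rw [mul_smul, neg_smul, smul_neg]
    rw [h1, h2, Literature.NumberTheory.EllipticCurves.TateModule.proj_pow_smul, Literature.NumberTheory.EllipticCurves.TateModule.pow_smul_proj]
  -- hence `ψ = ℓ^n g` for an additive `g` (divisibility of `E(K̄)`), and `d g ∈ M` by `(sat)`
  have hψg : ∃ g : W.geomPoints →+ W'.geomPoints, d • g ∈ M ∧ ψ = ((ℓ ^ n : ℕ) : ℤ) • g := by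
    obtain ⟨g, hg⟩ := Literature.AlgebraicGeometry.Motives.AddMonoidHom.exists_natCast_smul_eq (hsurj n) ψ fun P hP ↦
      hψtors P ((Submodule.mem_torsionBy_iff _ _).mpr hP)
    exact ⟨g, hdM g n (by rw [hg]; exact hψM), hg.symm⟩
  obtain ⟨g, hgM, hψg⟩ := hψg
  -- `d g = Σ b_i φ_i`
  obtain ⟨b, hb⟩ := (Submodule.mem_span_range_iff_exists_fun ℤ).mp hgM
  -- compare coefficients of `d ψ`
  have hcoeff : ∀ i, d * (a i : ℤ) - ((ℓ ^ n : ℕ) : ℤ) * b i = 0 := by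
    refine Fintype.linearIndependent_iff.mp hφs _ ?_
    calc ∑ i, (d * (a i : ℤ) - ((ℓ ^ n : ℕ) : ℤ) * b i) • (φ i).toAddMonoidHom
        = d • ψ - ((ℓ ^ n : ℕ) : ℤ) • ∑ i, b i • (φ i).toAddMonoidHom := by
          rw [hψ, Finset.smul_sum, Finset.smul_sum, ← Finset.sum_sub_distrib]
          refine Finset.sum_congr rfl fun i _ ↦ ?_
          rw [sub_smul, mul_smul, mul_smul]
      _ = 0 := by rw [hb, hψg, smul_comm, sub_self]
  -- conclude `ℓ^n ∣ d α_{i₀}`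
  have hi₀ : (d : ℤ_[ℓ]) * (a i₀ : ℤ_[ℓ]) = (ℓ : ℤ_[ℓ]) ^ n * (b i₀ : ℤ_[ℓ]) := by
    have := congrArg (fun z : ℤ ↦ (z : ℤ_[ℓ])) (sub_eq_zero.mp (hcoeff i₀))
    push_cast at this
    exact this
  refine ⟨(b i₀ : ℤ_[ℓ]) + (d : ℤ_[ℓ]) * β i₀, ?_⟩
  have hαi : α i₀ = (a i₀ : ℤ_[ℓ]) + (ℓ : ℤ_[ℓ]) ^ n * β i₀ := by
    rw [← hβ i₀, add_sub_cancel]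
  rw [hαi, mul_add, hi₀]
  ring

/-- **`(sat)` from the named facts.** For elliptic curves `E, E'` over `K`, the saturation
statement `(sat)` of `linearIndependent_tateModule_map_of_saturation` follows from
`mem_homModule_iff W W'` (`Hom_K` is a group), `Isogeny.exists_eq_comp_nsmul_of_geomTorsion_le_ker
W W'` (*AEC* Cor. III.4.11 for `[m]`) and `fg_divHull_homModule W W'` (`(*)` of *AEC* III.7.4):
if `m • f = ψ ∈ M ⊆ Hom_K` then `ψ` kills `E[m]`, so `ψ = 0` or `ψ = λ ∘ [m]` with `λ` an isogeny,
and `f = 0` resp. `f = λ` because `[m]` is onto on `E(K̄)`; hence `f ∈ M^div`, and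
`d • M^div ⊆ M`. [cite: SilvermanAEC2009, Thm. III.7.4 (proof)] -/
theorem saturation_of_facts [W.IsElliptic] [W'.IsElliptic]
    (hHom : mem_homModule_iff W W')
    (h411 : Isogeny.exists_eq_comp_nsmul_of_geomTorsion_le_ker W W')
    (hdiv : fg_divHull_homModule W W')
    (M : Submodule ℤ (W.geomPoints →+ W'.geomPoints))
    (hM : M ≤ Submodule.span ℤ (Set.range
      (Isogeny.toAddMonoidHom : Isogeny W W' → W.geomPoints →+ W'.geomPoints)))
    (hfg : M.FG) : ∃ d : ℤ, 0 < d ∧ ∀ (f : W.geomPoints →+ W'.geomPoints) (m : ℕ), (m : K) ≠ 0 →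
      (m : ℤ) • f ∈ M → d • f ∈ M := by
  obtain ⟨d, hd, h⟩ := exists_pos_forall_smul_mem_of_fg_divHull (hdiv M hM hfg)
  refine ⟨d, hd, fun f m hm hfM ↦ ?_⟩
  have hm0 : m ≠ 0 := by rintro rfl; exact hm Nat.cast_zero
  have hmpos : (0 : ℤ) < m := Int.natCast_pos.mpr (Nat.pos_of_ne_zero hm0)
  have hsurj : Function.Surjective fun Q : W.geomPoints ↦ (m : ℤ) • Q :=
    zsmul_geomPoints_surjective_holds W (Int.natCast_ne_zero.mpr hm0)
  -- an additive map `f'` with `m • f' = m • f` equals `f`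
  have huniq : ∀ f' : W.geomPoints →+ W'.geomPoints, (m : ℤ) • f' = (m : ℤ) • f → f' = f := by
    intro f' hf'
    ext Q
    obtain ⟨P, rfl⟩ := hsurj Q
    have := congrArg (fun g : W.geomPoints →+ W'.geomPoints ↦ g P) hf'
    simpa only [AddMonoidHom.smul_apply, ← map_zsmul] using this
  refine h f ?_ m hmpos hfM
  -- `f ∈ Hom_K`: `m • f ∈ M ⊆ Hom_K` is `0` or an isogeny killing `E[m]`
  rcases (hHom _).mp (hM hfM) with h0 | ⟨χ, hχ⟩
  · have hf0 : f = 0 := (huniq 0 (by rw [smul_zero, h0])).symm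
    rw [hf0]
    exact Submodule.zero_mem _
  · obtain ⟨lam, hlam⟩ := h411 hm χ fun P hP ↦ by
      rw [← Isogeny.coe_toAddMonoidHom, hχ, AddMonoidHom.smul_apply, ← map_zsmul,
        (Submodule.mem_torsionBy_iff _ _).mp hP, map_zero]
    have hflam : lam.toAddMonoidHom = f := huniq _ (by
      rw [← hχ]
      ext P
      rw [AddMonoidHom.smul_apply, ← map_zsmul, Isogeny.coe_toAddMonoidHom,
        Isogeny.coe_toAddMonoidHom, hlam P, natCast_zsmul])
    rw [← hflam]
    exact lam.toAddMonoidHom_mem_homModule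

/-- **Silverman, *AEC*, Thm. III.7.4, from three named facts** (improving
`linearIndependent_tateModule_map_of_facts`, which also assumed `#E[m] = m²`): the named fact
`linearIndependent_tateModule_map ℓ` follows from `mem_homModule_iff W W'`,
`Isogeny.exists_eq_comp_nsmul_of_geomTorsion_le_ker W W'` and `fg_divHull_homModule W W'`, the
surjectivity of `[n]` on `E(K̄)` being proved in the tree.
[cite: SilvermanAEC2009, Thm. III.7.4 (proof)] -/
theorem linearIndependent_tateModule_map_of_facts₂
    (hHom : mem_homModule_iff W W')
    (h411 : Isogeny.exists_eq_comp_nsmul_of_geomTorsion_le_ker W W')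
    (hdiv : fg_divHull_homModule W W') :
    linearIndependent_tateModule_map.{u, v} (W := W) (W' := W') ℓ := by
  intro _ _ hℓ ι φ hφ
  refine linearIndependent_tateModule_map_of_saturation ℓ (fun M hM hfg ↦ ?_) φ hφ
  obtain ⟨d, hd, h⟩ := saturation_of_facts hHom h411 hdiv M hM hfg
  exact ⟨d, hd, fun f n hf ↦ h f (ℓ ^ n) (by rw [Nat.cast_pow]; exact pow_ne_zero _ hℓ) hf⟩

/-- **Silverman, *AEC*, Thm. III.7.4, from the two remaining named facts.** With `Hom_K(E, E')`
a group now proved (`WeierstrassCurve.mem_homModule_iff_holds`, file `IsogenyHomProofs`) and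
`[n]` onto on `E(K̄)` (`PointDivisibilityProofs`), the named fact
`linearIndependent_tateModule_map ℓ` follows from *AEC* Cor. III.4.11 for `[m]`
(`Isogeny.exists_eq_comp_nsmul_of_geomTorsion_le_ker W W'`) and statement `(*)` of the proof of
III.7.4 (`fg_divHull_homModule W W'`) alone. [cite: SilvermanAEC2009, Thm. III.7.4 (proof)] -/
theorem linearIndependent_tateModule_map_of_facts₃
    (h411 : Isogeny.exists_eq_comp_nsmul_of_geomTorsion_le_ker W W')
    (hdiv : fg_divHull_homModule W W') :
    linearIndependent_tateModule_map.{u, v} (W := W) (W' := W') ℓ :=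
  linearIndependent_tateModule_map_of_facts₂ ℓ (mem_homModule_iff_holds W W') h411 hdiv

/-! ## The degree route: III.7.4 from Cor. III.6.3 and Thm. III.4.10(a)

A Gram-determinant form of Silverman's `(*)`, which needs `deg` only through the parallelogram
law, positivity, and `#ker φ ∣ deg φ` (module docstring, "The degree route"). -/

section DegreeRoute

open QuadraticMap in
/-- **Jordan–von Neumann over `ℤ`.** If `q : H → ℤ` satisfies the parallelogram law
`q (x + y) + q (x - y) = 2 q x + 2 q y` on a subgroup `S`, then its polar form
`⟨x, y⟩ = q (x + y) - q x - q y` is additive in the first variable on `S` (nine instances of the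
parallelogram law give `3 · (defect) = 0`). This converts the parallelogram form of "quadratic
form" into Silverman's (bilinear pairing, *AEC* III.§6, Definition before Cor. III.6.3).
[folklore] -/
theorem polar_add_left_of_parallelogram {H : Type*} [AddCommGroup H] {S : Submodule ℤ H}
    {q : H → ℤ} (hpar : ∀ x ∈ S, ∀ y ∈ S, q (x + y) + q (x - y) = 2 * q x + 2 * q y)
    {x y z : H} (hx : x ∈ S) (hy : y ∈ S) (hz : z ∈ S) :
    polar q (x + y) z = polar q x z + polar q y z := by
  rw [polar_add_left_iff]
  have h1 : q (x + y + z) + q (x + y - z) = 2 * q (x + y) + 2 * q z :=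
    hpar _ (add_mem hx hy) _ hz
  have h2 : q (x + y + z) + q (x - y + z) = 2 * q (x + z) + 2 * q y := by
    have := hpar _ (add_mem hx hz) _ hy
    rwa [show x + z + y = x + y + z by abel, show x + z - y = x - y + z by abel] at this
  have h3 : q (x + y + z) + q (-x + y + z) = 2 * q (y + z) + 2 * q x := by
    have := hpar _ (add_mem hy hz) _ hx
    rwa [show y + z + x = x + y + z by abel, show y + z - x = -x + y + z by abel] at this
  have h4 : q (x + y - z) + q (x - y + z) = 2 * q x + 2 * q (y - z) := by
    have := hpar _ hx _ (sub_mem hy hz)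
    rwa [show x + (y - z) = x + y - z by abel, show x - (y - z) = x - y + z by abel] at this
  have h5 : q (x + y - z) + q (-x + y + z) = 2 * q y + 2 * q (x - z) := by
    have := hpar _ hy _ (sub_mem hx hz)
    rwa [show y + (x - z) = x + y - z by abel, show y - (x - z) = -x + y + z by abel] at this
  have h6 : q (x - y + z) + q (-x + y + z) = 2 * q z + 2 * q (x - y) := by
    have := hpar _ hz _ (sub_mem hx hy)
    rwa [show z + (x - y) = x - y + z by abel, show z - (x - y) = -x + y + z by abel] at this
  have h7 := hpar _ hx _ hy
  have h8 := hpar _ hx _ hz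
  have h9 := hpar _ hy _ hz
  rw [show z + x = x + z from add_comm z x]
  omega

open QuadraticMap in
/-- For `x ∈ S`, the polar form `y ↦ q (x + y) - q x - q y` is an additive map `S →+ ℤ`
(parallelogram law on `S`). [folklore] -/
theorem exists_polar_addMonoidHom {H : Type*} [AddCommGroup H] {S : Submodule ℤ H}
    {q : H → ℤ} (hpar : ∀ x ∈ S, ∀ y ∈ S, q (x + y) + q (x - y) = 2 * q x + 2 * q y)
    {x : H} (hx : x ∈ S) : ∃ B : S →+ ℤ, ∀ y : S, B y = polar q x y := by
  have h0 : q 0 = 0 := by have := hpar 0 S.zero_mem 0 S.zero_mem; simp at this; omega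
  refine ⟨{ toFun := fun y ↦ polar q x y, map_zero' := ?_, map_add' := fun y z ↦ ?_ }, fun y ↦ rfl⟩
  · simp [polar, h0]
  · simp only [Submodule.coe_add]
    rw [polar_comm, polar_add_left_of_parallelogram hpar y.2 z.2 hx, polar_comm q (y : H),
      polar_comm q (z : H)]

open QuadraticMap Matrix in
/-- **Saturation from an integral positive definite quadratic form** (the Gram-determinant
argument of "The degree route" in the module docstring). Let `H` be a torsion-free abelian group,
`M ⊆ H` a finitely generated subgroup, `q : H → ℤ` a function satisfying the parallelogram law on
`M` and positive on `M ∖ {0}`, and `k ≥ 1` an integer such that `k^{2n} ∣ q x` whenever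
`x ∈ M ∩ k^n H`. Then there is an integer `d ≥ 1` (namely `|det G|`, `G` the Gram matrix of the
polar form on a `ℤ`-basis of the free module `M`) with `d • f ∈ M` for every `f ∈ H` and `n` with
`k^n • f ∈ M`. This replaces Silverman's "`M^div` is a discrete subgroup of `M ⊗ ℝ`, hence finitely
generated" (*AEC* III.7.4, proof of `(*)`, p. 85) by integral linear algebra
(`adj(G) G = det(G) · 1`). [folklore] -/
theorem exists_pos_forall_smul_mem_of_parallelogram {H : Type*} [AddCommGroup H]
    [NoZeroSMulDivisors ℤ H] {M : Submodule ℤ H} (hfg : M.FG) (q : H → ℤ) {k : ℕ} (hk : 0 < k)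
    (hpar : ∀ x ∈ M, ∀ y ∈ M, q (x + y) + q (x - y) = 2 * q x + 2 * q y)
    (hpos : ∀ x ∈ M, x ≠ 0 → 0 < q x)
    (hint : ∀ (n : ℕ) (f : H), (k : ℤ) ^ n • f ∈ M → (k : ℤ) ^ (2 * n) ∣ q ((k : ℤ) ^ n • f)) :
    ∃ d : ℤ, 0 < d ∧ ∀ (f : H) (n : ℕ), (k : ℤ) ^ n • f ∈ M → d • f ∈ M := by
  classical
  have h0 : q 0 = 0 := by have := hpar 0 M.zero_mem 0 M.zero_mem; simp at this; omega
  haveI : Module.Finite ℤ M := Module.Finite.iff_fg.mpr hfg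
  haveI : Module.Free ℤ M := Module.free_of_finite_type_torsion_free'
  set ι := Module.Free.ChooseBasisIndex ℤ M
  set b : Module.Basis ι ℤ M := Module.Free.chooseBasis ℤ M with hb
  -- polar form, additive in the second variable
  choose B hB using fun (x : M) ↦ exists_polar_addMonoidHom hpar x.2
  have hBsum : ∀ (x : M) (c : ι → ℤ),
      polar q (x : H) (((∑ i, c i • b i : M) : H)) = ∑ i, c i * polar q (x : H) (b i : H) := by
    intro x c
    rw [← hB, map_sum]
    exact Finset.sum_congr rfl fun i _ ↦ by rw [map_zsmul, hB, smul_eq_mul]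
  -- Gram matrix
  set G : Matrix ι ι ℤ := Matrix.of fun i j ↦ polar q (b i : H) (b j : H) with hG
  have hGmul : ∀ (c : ι → ℤ) (j : ι),
      (G *ᵥ c) j = polar q (b j : H) (((∑ i, c i • b i : M) : H)) := by
    intro c j
    rw [hBsum, Matrix.mulVec, dotProduct]
    exact Finset.sum_congr rfl fun i _ ↦ by rw [hG, Matrix.of_apply, mul_comm]
  have hpolar_self : ∀ x ∈ M, polar q x x = 2 * q x := by
    intro x hx
    have := hpar x hx x hx
    rw [sub_self, h0] at this
    rw [polar]; omega
  -- `det G ≠ 0` by positivity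
  have hdet : G.det ≠ 0 := by
    intro hdet
    obtain ⟨c, hc0, hGc⟩ := Matrix.exists_mulVec_eq_zero_iff.mpr hdet
    set χ : M := ∑ i, c i • b i with hχ
    have hχ0 : (χ : H) ≠ 0 := by
      intro h
      apply hc0
      have h' : χ = 0 := Subtype.ext h
      have hli := Fintype.linearIndependent_iff.mp b.linearIndependent c (by rw [← hχ, h'])
      exact funext hli
    have h1 : c ⬝ᵥ (G *ᵥ c) = polar q (χ : H) (χ : H) := by
      rw [dotProduct]
      calc ∑ j, c j * (G *ᵥ c) j = ∑ j, c j * polar q (χ : H) (b j : H) :=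
            Finset.sum_congr rfl fun j _ ↦ by rw [hGmul, ← hχ, polar_comm]
        _ = polar q (χ : H) (χ : H) := by rw [hχ]; exact (hBsum χ c).symm
    rw [hGc, dotProduct_zero, hpolar_self _ χ.2] at h1
    have := hpos _ χ.2 hχ0
    omega
  refine ⟨|G.det|, abs_pos.mpr hdet, fun f n hf ↦ ?_⟩
  have hkn : ((k : ℤ) ^ n) ≠ 0 := pow_ne_zero _ (Int.natCast_ne_zero.mpr hk.ne')
  set ψ : M := ⟨(k : ℤ) ^ n • f, hf⟩ with hψ
  set a : ι → ℤ := fun i ↦ b.repr ψ i with ha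
  have hψsum : (∑ i, a i • b i : M) = ψ := by rw [ha]; exact b.sum_repr ψ
  -- `k ^ n ∣ (G a)_j`
  have hdvd : ∀ j, (k : ℤ) ^ n ∣ (G *ᵥ a) j := by
    intro j
    rw [hGmul, hψsum]
    have hkk : (k : ℤ) ^ (2 * n) = (k : ℤ) ^ n * (k : ℤ) ^ n := by rw [two_mul, pow_add]
    have e1 : (k : ℤ) ^ n * polar q (b j : H) (ψ : H) =
        polar q (ψ : H) ((k : ℤ) ^ n • (b j : H)) := by
      rw [polar_comm]
      have := hB ψ ((k : ℤ) ^ n • b j)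
      rw [map_zsmul, hB, smul_eq_mul] at this
      rw [this, Submodule.coe_smul]
    have d1 : (k : ℤ) ^ (2 * n) ∣ q ((ψ : H) + (k : ℤ) ^ n • (b j : H)) := by
      have e : (ψ : H) + (k : ℤ) ^ n • (b j : H) = (k : ℤ) ^ n • (f + (b j : H)) := by
        rw [hψ, smul_add]
      rw [e]
      refine hint n _ ?_
      rw [← e]
      exact add_mem ψ.2 (M.smul_mem _ (b j).2)
    have d2 : (k : ℤ) ^ (2 * n) ∣ q (ψ : H) := hint n f hf
    have d3 : (k : ℤ) ^ (2 * n) ∣ q ((k : ℤ) ^ n • (b j : H)) :=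
      hint n _ (M.smul_mem _ (b j).2)
    have d4 : (k : ℤ) ^ (2 * n) ∣ (k : ℤ) ^ n * polar q (b j : H) (ψ : H) := by
      rw [e1, polar]
      exact dvd_sub (dvd_sub d1 d2) d3
    rw [hkk] at d4
    exact (mul_dvd_mul_iff_left hkn).mp d4
  choose w hw using hdvd
  -- `det G • a = k ^ n • adj(G) w`
  have hdeta : ∀ i, G.det * a i = (k : ℤ) ^ n * (G.adjugate *ᵥ w) i := by
    intro i
    have h1 : G.adjugate *ᵥ (G *ᵥ a) = G.det • a := by
      rw [mulVec_mulVec, adjugate_mul, smul_mulVec, one_mulVec]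
    have h2 : G *ᵥ a = (k : ℤ) ^ n • w := funext fun j ↦ by rw [hw, Pi.smul_apply, smul_eq_mul]
    rw [h2, mulVec_smul] at h1
    have := congrFun h1 i
    simp only [Pi.smul_apply, smul_eq_mul] at this
    exact this.symm
  -- hence `det G • f ∈ M`
  have hmem : G.det • f ∈ M := by
    have h2 : G.det • ψ = (k : ℤ) ^ n • (∑ i, (G.adjugate *ᵥ w) i • b i : M) := by
      have : G.det • ψ = ∑ i, (G.det * a i) • b i := by
        rw [← hψsum, Finset.smul_sum]
        exact Finset.sum_congr rfl fun i _ ↦ by rw [smul_smul]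
      rw [this, Finset.smul_sum]
      exact Finset.sum_congr rfl fun i _ ↦ by rw [hdeta, ← smul_smul]
    have h1 : (k : ℤ) ^ n • (G.det • f) =
        (k : ℤ) ^ n • ((∑ i, (G.adjugate *ᵥ w) i • b i : M) : H) := by
      have := congrArg (Subtype.val : M → H) h2
      simp only [Submodule.coe_smul_of_tower, hψ] at this
      rw [smul_comm]
      exact this
    rw [smul_right_injective H hkn h1]
    exact Submodule.coe_mem _
  rcases abs_choice G.det with h | h <;> rw [h]
  · exact hmem
  · rw [neg_smul]; exact M.neg_mem hmem


/-- **`Hom(E(K̄), E'(K̄))` is torsion-free** for an elliptic curve `E`: if `m • f = 0` with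
`m ≠ 0` then `f (m • P) = 0` for all `P`, and `[m]` is onto on `E(K̄)`
(`WeierstrassCurve.zsmul_geomPoints_surjective_holds`). Silverman, *AEC*, Prop. III.4.2(b)
(for `Hom(E₁, E₂)`). [folklore] -/
theorem noZeroSMulDivisors_int_addMonoidHom [W.IsElliptic] :
    NoZeroSMulDivisors ℤ (W.geomPoints →+ W'.geomPoints) := by
  refine ⟨fun {c f} h ↦ or_iff_not_imp_left.mpr fun hc ↦ ?_⟩
  ext Q
  obtain ⟨P, rfl⟩ := zsmul_geomPoints_surjective_holds W hc Q
  have := congrArg (fun g : W.geomPoints →+ W'.geomPoints ↦ g P) h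
  simpa only [AddMonoidHom.smul_apply, ← map_zsmul, AddMonoidHom.zero_apply] using this

/-- If an isogeny `χ : E → E'` over `K` kills `E[m]` and `m ≠ 0` in `K`, then `m² ∣ #ker χ`:
`E[m] ⊆ ker χ` has order `m²` (`WeierstrassCurve.card_torsionPoints_eq_sq_holds`, *AEC*
Cor. III.6.4(b)) and Lagrange. [folklore] -/
theorem sq_dvd_card_ker [W.IsElliptic] {m : ℕ} (hm : (m : K) ≠ 0) (χ : Isogeny W W')
    (hχ : ∀ P ∈ geomTorsion W m, χ P = 0) :
    ((m : ℤ) ^ 2) ∣ (Nat.card χ.toAddMonoidHom.ker : ℤ) := by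
  have hm' : ((m : ℕ) : AlgebraicClosure K) ≠ 0 := by
    intro h
    apply hm
    have : (algebraMap K (AlgebraicClosure K)) (m : K) = 0 := by rw [map_natCast, h]
    exact (map_eq_zero _).mp this
  have hcard : Nat.card (geomTorsion W (m : ℕ)) = m ^ 2 :=
    card_torsionPoints_eq_sq_holds W (AlgebraicClosure K) hm'
  have hle : geomTorsion W (m : ℕ) ≤ χ.toAddMonoidHom.ker := fun P hP ↦ by
    rw [AddMonoidHom.mem_ker]
    exact hχ P hP
  have := AddSubgroup.card_dvd_of_le hle
  rw [hcard] at this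
  exact_mod_cast this

/-- **`(sat)_ℓ` from a degree function** (see "The degree route" in the module docstring). Let
`E, E'` be elliptic curves over `K`, `ℓ` a prime with `ℓ ≠ 0` in `K`, and
`deg : Hom(E(K̄), E'(K̄)) → ℤ` a function which on `Hom_K(E, E')` satisfies the parallelogram law
and is positive on non-zero elements (Silverman, *AEC*, Cor. III.6.3: `deg` is a positive definite
quadratic form on `Hom(E₁, E₂)`, with `deg 0 = 0`), and such that `#ker φ ∣ deg φ` for every
isogeny `φ` over `K` (Thm. III.4.10(a): `#ker φ = deg_s φ`, a divisor of
`deg φ = deg_s φ · deg_i φ`).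
Then for every finitely generated `M ⊆ Hom_K(E, E')` there is `d ≥ 1` with `d • f ∈ M` for every
additive `f` and `n` with `ℓ^n • f ∈ M`: apply `Literature.AlgebraicGeometry.Motives.exists_pos_forall_smul_mem_of_parallelogram`,
the divisibility `ℓ^{2n} ∣ deg (ℓ^n • f)` coming from `E[ℓ^n] ⊆ ker (ℓ^n • f)` (`sq_dvd_card_ker`;
`ℓ^n • f ∈ Hom_K` is `0` or an isogeny by `WeierstrassCurve.mem_homModule_iff_holds`).
[cite: SilvermanAEC2009, Thm. III.7.4 (proof, statement (*)), Cor. III.6.3, Thm. III.4.10(a)] -/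
theorem saturation_of_degree [W.IsElliptic] [W'.IsElliptic] (hℓ : (ℓ : K) ≠ 0)
    (deg : (W.geomPoints →+ W'.geomPoints) → ℤ)
    (hpar : ∀ φ ∈ homModule W W', ∀ ψ ∈ homModule W W',
      deg (φ + ψ) + deg (φ - ψ) = 2 * deg φ + 2 * deg ψ)
    (hpos : ∀ φ ∈ homModule W W', φ ≠ 0 → 0 < deg φ)
    (hker : ∀ φ : Isogeny W W', (Nat.card φ.toAddMonoidHom.ker : ℤ) ∣ deg φ.toAddMonoidHom)
    (M : Submodule ℤ (W.geomPoints →+ W'.geomPoints)) (hM : M ≤ homModule W W') (hfg : M.FG) :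
    ∃ d : ℤ, 0 < d ∧ ∀ (f : W.geomPoints →+ W'.geomPoints) (n : ℕ),
      ((ℓ ^ n : ℕ) : ℤ) • f ∈ M → d • f ∈ M := by
  haveI := noZeroSMulDivisors_int_addMonoidHom (W := W) (W' := W')
  have h0 : deg 0 = 0 := by
    have := hpar 0 (Submodule.zero_mem _) 0 (Submodule.zero_mem _)
    simp only [add_zero, sub_zero] at this
    omega
  have hint : ∀ (n : ℕ) (f : W.geomPoints →+ W'.geomPoints), (ℓ : ℤ) ^ n • f ∈ M →
      (ℓ : ℤ) ^ (2 * n) ∣ deg ((ℓ : ℤ) ^ n • f) := by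
    intro n f hf
    rcases (mem_homModule_iff_holds W W' ((ℓ : ℤ) ^ n • f)).mp (hM hf) with h0' | ⟨χ, hχ⟩
    · rw [h0', h0]; exact dvd_zero _
    · rw [← hχ]
      refine dvd_trans ?_ (hker χ)
      have hℓn : ((ℓ ^ n : ℕ) : K) ≠ 0 := by rw [Nat.cast_pow]; exact pow_ne_zero _ hℓ
      have := sq_dvd_card_ker hℓn χ fun P hP ↦ by
        rw [← Isogeny.coe_toAddMonoidHom, hχ, AddMonoidHom.smul_apply, ← map_zsmul,
          ← Nat.cast_pow, (Submodule.mem_torsionBy_iff _ _).mp hP, map_zero]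
      rwa [Nat.cast_pow, ← pow_mul, mul_comm] at this
  obtain ⟨d, hd, h⟩ := exists_pos_forall_smul_mem_of_parallelogram hfg deg
    (Fact.out : ℓ.Prime).pos (fun x hx y hy ↦ hpar x (hM hx) y (hM hy))
    (fun x hx ↦ hpos x (hM hx)) hint
  exact ⟨d, hd, fun f n hf ↦ h f n (by rwa [Nat.cast_pow] at hf)⟩


/-- **Silverman, *AEC*, Thm. III.7.4, from the degree map** (Cor. III.6.3 and Thm. III.4.10(a)
as hypotheses on an abstract function `deg`; no use of Cor. III.4.11): for elliptic curves `E, E'`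
over `K` and a prime `ℓ ≠ char K`, `ℤ`-independent isogenies over `K` have `ℤ_ℓ`-independent
Tate-module maps, provided there is `deg : Hom(E(K̄), E'(K̄)) → ℤ` satisfying on `Hom_K(E, E')` the
parallelogram law and positivity on non-zero elements (III.6.3) and `#ker φ ∣ deg φ` for isogenies
`φ` (III.4.10(a)). Combine `saturation_of_degree` with
`linearIndependent_tateModule_map_of_saturation`.
[cite: SilvermanAEC2009, Thm. III.7.4 with Cor. III.6.3 and Thm. III.4.10(a)] -/
theorem linearIndependent_tateModule_map_of_degree (deg : (W.geomPoints →+ W'.geomPoints) → ℤ)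
    (hpar : ∀ φ ∈ homModule W W', ∀ ψ ∈ homModule W W',
      deg (φ + ψ) + deg (φ - ψ) = 2 * deg φ + 2 * deg ψ)
    (hpos : ∀ φ ∈ homModule W W', φ ≠ 0 → 0 < deg φ)
    (hker : ∀ φ : Isogeny W W', (Nat.card φ.toAddMonoidHom.ker : ℤ) ∣ deg φ.toAddMonoidHom) :
    linearIndependent_tateModule_map.{u, v} (W := W) (W' := W') ℓ := by
  intro _ _ hℓ ι φ hφ
  exact linearIndependent_tateModule_map_of_saturation ℓ
    (fun M hM hfg ↦ saturation_of_degree ℓ hℓ deg hpar hpos hker M hM hfg) φ hφ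

/-- **Silverman, *AEC*, Thm. III.7.4, from Thm. II.2.4(a), Thm. III.4.10(a) and Cor. III.6.3**
for the genuine degree `deg φ = [K̄(E) : φ^* K̄(E')]` of
`Literature.NumberTheory.EllipticCurves.IsogenyDegree`: the named fact
`linearIndependent_tateModule_map ℓ` follows from the three named facts
`Isogeny.finiteDimensional_pullbackField W W'` (II.2.4(a): `deg φ ≥ 1`),
`Isogeny.card_ker_eq_finSepDegree W W'` (III.4.10(a): `#ker φ = deg_s φ ∣ deg φ`) and
`degHom_isQuadraticForm W W'` (III.6.3: parallelogram law for `deg` on `Hom_K(E, E')`), through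
`linearIndependent_tateModule_map_of_degree` applied to `deg := degHom W W'`.
[cite: SilvermanAEC2009, Thm. III.7.4 with Thm. II.2.4(a), Thm. III.4.10(a), Cor. III.6.3] -/
theorem linearIndependent_tateModule_map_of_degreeFacts
    (hfin : Isogeny.finiteDimensional_pullbackField W W')
    (h410 : Isogeny.card_ker_eq_finSepDegree W W')
    (h63 : degHom_isQuadraticForm W W') :
    linearIndependent_tateModule_map.{u, v} (W := W) (W' := W') ℓ := by
  intro _ _ hℓ ι φ hφ
  exact linearIndependent_tateModule_map_of_degree ℓ (degHom W W')
    (fun f hf g hg ↦ degHom_parallelogram h63 hf hg)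
    (fun f hf hf0 ↦ degHom_pos hfin hf hf0)
    (fun χ ↦ by
      rw [degHom_toAddMonoidHom]
      exact_mod_cast χ.card_ker_dvd_deg h410)
    hℓ φ hφ

/-- **Silverman, *AEC*, Thm. III.7.4, from `#ker φ ∣ deg φ` and Cor. III.6.3** (the weakest
interface of the degree route for the genuine degree of `IsogenyDegree`): besides the finiteness
II.2.4(a) (`hfin`) and the quadratic form III.6.3 (`h63`), only the divisibility
`#ker φ ∣ deg φ = [K̄(E) : φ^* K̄(E')]` is used (`hdvd`; a consequence of III.4.10(a), but also of
the Galois theory of `K̄(E) / φ^* K̄(E')`, III.4.10(b): `ker φ` acts faithfully by translations).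
[cite: SilvermanAEC2009, Thm. III.7.4 with Thm. II.2.4(a), Thm. III.4.10, Cor. III.6.3] -/
theorem linearIndependent_tateModule_map_of_card_ker_dvd_deg
    (hfin : Isogeny.finiteDimensional_pullbackField W W')
    (hdvd : ∀ [W.IsElliptic] [W'.IsElliptic] (χ : Isogeny W W'),
      Nat.card χ.toAddMonoidHom.ker ∣ χ.deg)
    (h63 : degHom_isQuadraticForm W W') :
    linearIndependent_tateModule_map.{u, v} (W := W) (W' := W') ℓ := by
  intro _ _ hℓ ι φ hφ
  exact linearIndependent_tateModule_map_of_degree ℓ (degHom W W')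
    (fun f hf g hg ↦ degHom_parallelogram h63 hf hg)
    (fun f hf hf0 ↦ degHom_pos hfin hf hf0)
    (fun χ ↦ by
      rw [degHom_toAddMonoidHom]
      exact_mod_cast hdvd χ)
    hℓ φ hφ

/-- **Silverman, *AEC*, Thm. III.7.4, from Cor. III.6.3 alone.** For Weierstrass curves `W, W'`
over a field `K` and a prime `ℓ`, the named fact `linearIndependent_tateModule_map ℓ` (for
elliptic `E, E'` and `ℓ ≠ char K`, `ℤ`-independent isogenies `E → E'` over `K` have
`ℤ_ℓ`-independent Tate-module maps) follows from the one named fact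
`WeierstrassCurve.degHom_isQuadraticForm W W'` (Cor. III.6.3: `deg (-φ) = deg φ` and
`deg (φ + ψ) - deg φ - deg ψ` is bilinear on `Hom_K(E, E')`): the other two inputs of the degree
route are the theorems `Isogeny.finiteDimensional_pullbackField_holds` (Thm. II.2.4(a)) and
`Isogeny.card_ker_dvd_deg_holds` (`#ker φ ∣ deg φ`, from the proof of Thm. III.4.10(b)).
[cite: SilvermanAEC2009, Thm. III.7.4 with Cor. III.6.3] -/
theorem linearIndependent_tateModule_map_of_isQuadraticForm (h63 : degHom_isQuadraticForm W W') :
    linearIndependent_tateModule_map.{u, v} (W := W) (W' := W') ℓ :=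
  linearIndependent_tateModule_map_of_card_ker_dvd_deg ℓ
    (Isogeny.finiteDimensional_pullbackField_holds W W') (fun χ ↦ χ.card_ker_dvd_deg_holds) h63

/-- **Silverman, *AEC*, Thm. III.7.4, discharged.** For Weierstrass curves `W, W'` over a field
`K` and a prime `ℓ`, the named fact `linearIndependent_tateModule_map ℓ` holds: for elliptic
`E, E'` and `ℓ ≠ char K`, `ℤ`-linearly independent isogenies `E → E'` over `K` have
`ℤ_ℓ`-linearly independent Tate-module maps, i.e. `Hom_K(E, E') ⊗ ℤ_ℓ → Hom(T_ℓ E, T_ℓ E')` is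
injective. Proof: the degree route `linearIndependent_tateModule_map_of_degree` applied to the
polar degree `WeierstrassCurve.polarDegHom` of
`Literature.NumberTheory.EllipticCurves.IsogenyPolarDegree`, whose parallelogram law on
`Hom_K(E, E')` (Cor. III.6.3), positivity (Thm. II.2.4(a)) and divisibility `#ker φ ∣ deg φ`
(Thm. III.4.10(a)) are the theorems `polarDegHom_parallelogram`, `polarDegHom_pos` and
`Isogeny.card_ker_dvd_polarDegHom` there.
[cite: SilvermanAEC2009, Thm. III.7.4 with Cor. III.6.3 and Thm. III.4.10(a)] -/
theorem linearIndependent_tateModule_map_holds :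
    linearIndependent_tateModule_map.{u, v} (W := W) (W' := W') ℓ := by
  intro _ _ hℓ ι φ hφ
  exact linearIndependent_tateModule_map_of_degree ℓ (polarDegHom (W := W) (W' := W'))
    (fun f hf g hg ↦ polarDegHom_parallelogram hf hg)
    (fun f hf hf0 ↦ polarDegHom_pos hf hf0)
    (fun χ ↦ χ.card_ker_dvd_polarDegHom) hℓ φ hφ

end DegreeRoute

end Literature.AlgebraicGeometry.Motives
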